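import Literature.IUT.HodgeArakelov.ThetaEnvDataRecordModelOuter
import Literature.IUT.HodgeArakelov.BadPrimeGaussianMonoidsGenuineRecordSplittingProofs
import HarnessLib

/-!
# [IUTchII] Prop 3.1 (i)(ii): the PACKAGED statement structure `Prop31Statements` AT THE GENUINE `θ_env` RECORD —
# label transport of «splittings up to torsion» along the conjugation action (proof-only assembly)

S. Mochizuki, *Inter-universal Teichmüller theory II*, kurims manuscript (Dec. 2020), §3 Prop. 3.1 (i) p. 87 l. 47–53
(«one obtains a functorial algorithm `M^Θ_* ↦ {M^×_TM(M^Θ_*), θ^ι_env(M^Θ_*), ∞θ^ι_env(M^Θ_*), …}_ι` … where `ι` ranges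
over the inversion automorphisms of Proposition 2.2, (i) … equipped with a natural conjugation action by `Π_X(M^Θ_*)` …
splittings up to torsion»), (ii) p. 88 («`Ψ_cns(M^Θ_*)` … equipped with a natural conjugation action»)
[cite: Mochizuki2012, Prop 3.1 (i) p.87]. Claim key `Mochizuki2012` (D-0012, DISPUTED): every theorem below is
elementary algebra / composition of LANDED theorems over the cell's OWN objects; nothing of the series is asserted;
no side is taken on [IUTchIII] Cor. 3.12; typed ≠ proved ≠ endorsed. PROOF-ONLY companion (abc-iut cell, layer L6,
seat abc-iut-w5-d031 gen 11; L-F register row **LF6-02** = frozen FACT-LIST row **F-2567**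
`TemperedThetaMonoids.Prop31Statements` — «universal-closure REFUTED / schema; instance forms are the content»
(`TemperedThetaMonoidsProp31SchemaCertificate.lean`); cone node IUTchII:Prop3.1(i)). NO definition, NO `Prop` fact,
NO instance; nothing landed is edited or restated.

WHY. In the tree the three fields of abc-iut-L6-t2's `Prop31Statements E = ⟨conj_permutes, splitting, constants_stable⟩`
are proved FIELD-WISE at the genuine record `EtaleLevels.thetaEnvRecordKummer` (abc-iut-w4-d019,
`ThetaEnvDataRecordModel.lean`: `constantMonoid_stable_thetaEnvRecord`, `conj_permutes_thetaEnvRecord`; print-faithful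
OUTER family `ThetaEnvDataRecordModelOuter.lean`), EXCEPT that the `splitting` clause
(`IsSplittingUpToTorsion M^×_TM ⟨∞θ^ι_env⟩` for EVERY label `ι`) is landed only AT ONE LABEL `i₀` carrying a Cor. 3.5 (E)
evaluation datum (abc-iut-w4-d004 `EtaleLevels.splitting_toRecord_padic_of_eval`, p433555; abc-iut-w5-d072 `…_modelχq` /
`…_modelTate`, p460211 / p461404; abc-iut-w4-d035 `…_inversion_of_thetaKummerOrbit`, p488082). The packaged structure
(conclusion head `Prop31Statements`, which is what F-lit's instance census reads) was therefore ABSENT at the genuine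
record. THIS FILE supplies the one missing bookkeeping step — print's own mechanism, p. 87: the conjugation action
PERMUTES the labels, so a splitting at one label is carried to every label of its `Π_X(M^Θ_*)`-orbit — and assembles:

* §1 (any record `E : TemperedThetaMonoids.ThetaEnvData P`): `isSplittingUpToTorsion_inftyThetaEnv_of_image_eq` —
  transport of `IsSplittingUpToTorsion M^×_TM ⟨∞θ^ι_env⟩` along a unit-stabilising `conj g` with
  `conj g ″ ∞θ^ι_env = ∞θ^{ι'}_env`; `prop31Statements_of_splitting_at` — the WHOLE `Prop31Statements E` from J2
  (abc-iut-w5-d169's `ThetaEnvPermuted`), conjugation-stability of `Ψ_cns`, and a splitting at ONE label `i₀` from which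
  every label is reached by the action.
* §2 (abc-iut-w4-d019's bridge record `T.toRecord act κ iota`): the EXPLICIT-label form of J2 —
  `conj g ″ θ^ι_env = θ^{ι'}_env`, `conj g ″ ∞θ^ι_env = ∞θ^{ι'}_env` for any `ι'` whose action is the `g`-conjugate of
  that of `ι` (the bridge's `thetaEnvPermuted_toRecord` only records `∃ ι'`).
* §3 (the GENUINE record over the natural system of `X̲̲_K`, BOTH inversion families): `conj g ″ ∞θ^i_env = ∞θ^{g·i}_env`
  (inner family `thetaEnvRecord κ ι₀`; outer print-faithful family `thetaEnvRecordOuter κ e₀`), hence every label is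
  reached from every label, hence **`prop31Statements_thetaEnvRecordKummer_of_splitting_at`** /
  **`prop31Statements_thetaEnvRecordOuterKummer_of_splitting_at`**: `Prop31Statements (…)` modulo `hO`
  (`Π`-stability of the constant monoid `O`) and the splitting clause AT ONE LABEL — pluggable BY NAME from any of the
  landed one-label closers above.
* §4 (over `ℚ̄_pˣ`): **`prop31Statements_thetaEnvRecordKummer_padic_of_eval`** — §3 composed with abc-iut-w4-d004's
  `splitting_toRecord_padic_of_eval` (p433555): the packaged `Prop31Statements` at the genuine inner-family record over
  `ℚ̄_pˣ` from the Cor. 3.5 (K)/(E) DATA at one label (residual binders BY NAME exactly those of p433555 plus `hO`).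

HONEST FRAMING: an instance-form theorem at OUR record is not the print universal closure (refuted as a schema); the
residual hypotheses are structural data of the record ((H1) `PiYddCharacteristic` = F-2633 at the instance, the record
inputs, the Cor. 3.5 (K)/(E) data), listed in each docstring; no side taken on [IUTchIII] Cor. 3.12; nothing here
asserts that abc is proved or refuted. [claim: Mochizuki2012, status: disputed]
-/

noncomputable section

namespace Literature.IUT.HodgeArakelov

/-! ### §1. Generic record level: label transport of «splittings up to torsion» and the packaged structure -/

namespace TemperedThetaMonoids

namespace ThetaEnvData

universe u v

variable {P : Type u} [Group P] (E : ThetaEnvData.{u, v} P)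

/-- **Label transport of «splittings up to torsion»** ([IUTchII] Prop. 3.1 (i) p. 87: the conjugation action by
`Π_X(M^Θ_*)` permutes the labels `ι`): if `conj g` stabilises `M^×_TM` (for every `g`) and carries `∞θ^ι_env` onto
`∞θ^{ι'}_env`, then a splitting up to torsion of `(M^×_TM, ⟨∞θ^ι_env⟩)` yields one of `(M^×_TM, ⟨∞θ^{ι'}_env⟩)`:
an element of `M^×_TM ∩ ⟨∞θ^{ι'}_env⟩` is `conj g` of an element of `M^×_TM ∩ ⟨∞θ^ι_env⟩`, hence torsion.
[claim: Mochizuki2012, status: disputed] (IUTchII §3 Prop 3.1 (i), kurims p.87) -/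
theorem isSplittingUpToTorsion_inftyThetaEnv_of_image_eq (g : P) {ι ι' : E.Iota}
    (hU : ∀ (g : P) (x : E.H), x ∈ E.units → E.conj g x ∈ E.units)
    (hperm : E.conj g '' E.inftyThetaEnv ι = E.inftyThetaEnv ι')
    (h : IsSplittingUpToTorsion E.units (Submonoid.closure (E.inftyThetaEnv ι))) :
    IsSplittingUpToTorsion E.units (Submonoid.closure (E.inftyThetaEnv ι')) := by
  refine ⟨fun x hxU hxS => ?_⟩
  have hmap : Submonoid.closure (E.inftyThetaEnv ι') =
      (Submonoid.closure (E.inftyThetaEnv ι)).map (E.conj g).toMonoidHom := by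
    rw [MonoidHom.map_mclosure, MulEquiv.coe_toMonoidHom, hperm]
  rw [hmap, Submonoid.mem_map] at hxS
  obtain ⟨y, hy, rfl⟩ := hxS
  rw [MulEquiv.coe_toMonoidHom] at hxU ⊢
  have hyU : y ∈ E.units := by
    have h1 := hU g⁻¹ _ hxU
    rwa [map_inv, MulAut.inv_apply_self] at h1
  exact (E.conj g).toMonoidHom.isOfFinOrder (h.inter_torsion y hyU hy)

/-- The same transport for the `θ^ι_env`-splitting (`IsSplittingUpToTorsion M^×_TM ⟨θ^ι_env⟩`, the companion clause
landed with every one-label closer). [claim: Mochizuki2012, status: disputed] (IUTchII §3 Prop 3.1 (i), kurims p.87) -/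
theorem isSplittingUpToTorsion_thetaEnv_of_image_eq (g : P) {ι ι' : E.Iota}
    (hU : ∀ (g : P) (x : E.H), x ∈ E.units → E.conj g x ∈ E.units)
    (hperm : E.conj g '' E.thetaEnv ι = E.thetaEnv ι')
    (h : IsSplittingUpToTorsion E.units (Submonoid.closure (E.thetaEnv ι))) :
    IsSplittingUpToTorsion E.units (Submonoid.closure (E.thetaEnv ι')) := by
  refine ⟨fun x hxU hxS => ?_⟩
  have hmap : Submonoid.closure (E.thetaEnv ι') =
      (Submonoid.closure (E.thetaEnv ι)).map (E.conj g).toMonoidHom := by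
    rw [MonoidHom.map_mclosure, MulEquiv.coe_toMonoidHom, hperm]
  rw [hmap, Submonoid.mem_map] at hxS
  obtain ⟨y, hy, rfl⟩ := hxS
  rw [MulEquiv.coe_toMonoidHom] at hxU ⊢
  have hyU : y ∈ E.units := by
    have h1 := hU g⁻¹ _ hxU
    rwa [map_inv, MulAut.inv_apply_self] at h1
  exact (E.conj g).toMonoidHom.isOfFinOrder (h.inter_torsion y hyU hy)

/-- **The PACKAGED [IUTchII] Prop. 3.1 (i)(ii) statement structure from J2 + one splitting** (p. 87 l. 47–53, p. 88):
for a record `E` in which (J2) the conjugation action permutes `{θ^ι_env}_ι`, `{∞θ^ι_env}_ι` (abc-iut-w5-d169's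
`ThetaEnvPermuted`), `Ψ_cns` is conjugation-stable (whence `M^×_TM` is, abc-iut-w4-d035's
`units_conjStable_of_constants`), every label `ι` is reached from one label `i₀` by the action
(`conj g ″ ∞θ^{i₀}_env = ∞θ^ι_env` for some `g`), and `(M^×_TM, ⟨∞θ^{i₀}_env⟩)` is a splitting up to torsion, the
WHOLE structure `Prop31Statements E` holds. [claim: Mochizuki2012, status: disputed] (IUTchII §3 Prop 3.1 (i), kurims p.87) -/
theorem prop31Statements_of_splitting_at (hJ2 : E.ThetaEnvPermuted) (hcns : E.IsConjStable E.constantMonoid)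
    (i₀ : E.Iota) (hreach : ∀ ι : E.Iota, ∃ g : P, E.conj g '' E.inftyThetaEnv i₀ = E.inftyThetaEnv ι)
    (hsplit : IsSplittingUpToTorsion E.units (Submonoid.closure (E.inftyThetaEnv i₀))) :
    Prop31Statements E where
  conj_permutes g ι := by
    obtain ⟨ι', h, -⟩ :=
      E.conj_permutes_both_of_thetaEnvPermuted hJ2 (units_conjStable_of_constants E hcns) g ι
    exact ⟨ι', h⟩
  splitting ι := by
    obtain ⟨g, hg⟩ := hreach ι
    exact E.isSplittingUpToTorsion_inftyThetaEnv_of_image_eq g (units_conjStable_of_constants E hcns) hg hsplit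
  constants_stable := hcns

end ThetaEnvData

end TemperedThetaMonoids

/-! ### §2. Bridge record level: the EXPLICIT-label form of J2 -/

namespace ThetaEnvData

open Literature.AnabelianGeometry.EtaleTheta

universe u

variable {S : ThetaSetting.{u}} {F : ModelFamily S} {Sys : MonoThetaProjSystem F} (T : ThetaEnvData Sys)
  {act : Sys.PiX →* MulAut (Multiplicative T.cohEnv.lim)} {M : Type u} [CommMonoid M]
  {κ : M →* Multiplicative T.cohEnv.lim} {Iota : Type u} {iota : Iota → (T.D.coh.lim ≃+ T.D.coh.lim)}
  {actD : Sys.PiX → (T.D.coh.lim ≃+ T.D.coh.lim)}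

/-- **J2 with an EXPLICIT target label, `θ^ι_env`-half** (abc-iut-w4-d019's `thetaEnvPermuted_toRecord` made
label-explicit): for the produced record, if `act` is intertwined with `actD` by the cyclotomic rigidity isomorphism
(`hcompat`), `actD g` stabilises `toLim ⊤ ″ θ(Π)` (`hθ`), and the action of `ι'` is the `g`-conjugate of that of `ι`
(`hι'`), then `conj g ″ θ^ι_env = θ^{ι'}_env`. [claim: Mochizuki2012, status: disputed] (IUTchII §3 Prop 3.1 (i), kurims p.87) -/
theorem image_conj_toRecord_thetaEnv_eq
    (hcompat : ∀ (g : Sys.PiX) (x : T.D.coh.lim),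
      act g (Multiplicative.ofAdd (T.transportLim x)) = Multiplicative.ofAdd (T.transportLim (actD g x)))
    (hθ : ∀ g : Sys.PiX, actD g '' (T.D.coh.toLim ⊤ '' T.D.theta) = T.D.coh.toLim ⊤ '' T.D.theta)
    (g : Sys.PiX) {ι ι' : Iota} (hι' : ∀ x, iota ι' (actD g x) = actD g (iota ι x)) :
    (T.toRecord act κ iota).conj g '' (T.toRecord act κ iota).thetaEnv ι = (T.toRecord act κ iota).thetaEnv ι' := by
  change (act g) '' T.envSet (T.thetaIotaLim (iota ι)) = T.envSet (T.thetaIotaLim (iota ι'))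
  rw [T.image_envSet_of_compat (act g) (actD g) (hcompat g), thetaIotaLim, thetaIotaLim,
    T.image_iotaInvariants_of_conj (actD g) (iota ι) (iota ι') hι' (hθ g)]

/-- **J2 with an EXPLICIT target label, `∞θ^ι_env`-half**: under `hcompat`, `actD g` stabilising `∞θ(Π)` (`hinf`) and
`hι'`, `conj g ″ ∞θ^ι_env = ∞θ^{ι'}_env`. [claim: Mochizuki2012, status: disputed] (IUTchII §3 Prop 3.1 (i), kurims p.87) -/
theorem image_conj_toRecord_inftyThetaEnv_eq
    (hcompat : ∀ (g : Sys.PiX) (x : T.D.coh.lim),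
      act g (Multiplicative.ofAdd (T.transportLim x)) = Multiplicative.ofAdd (T.transportLim (actD g x)))
    (hinf : ∀ g : Sys.PiX, actD g '' T.D.thetaInfty = T.D.thetaInfty)
    (g : Sys.PiX) {ι ι' : Iota} (hι' : ∀ x, iota ι' (actD g x) = actD g (iota ι x)) :
    (T.toRecord act κ iota).conj g '' (T.toRecord act κ iota).inftyThetaEnv ι =
      (T.toRecord act κ iota).inftyThetaEnv ι' := by
  change (act g) '' T.envSet (T.thetaInftyIotaLim (iota ι)) = T.envSet (T.thetaInftyIotaLim (iota ι'))
  rw [T.image_envSet_of_compat (act g) (actD g) (hcompat g), thetaInftyIotaLim, thetaInftyIotaLim,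
    T.image_iotaInvariants_of_conj (actD g) (iota ι) (iota ι') hι' (hinf g)]

end ThetaEnvData

/-! ### §3. The GENUINE record over the natural system of `X̲̲_K`: every label is reached; the packaged structure -/

namespace EtaleLevels

open Literature.AnabelianGeometry.EtaleTheta CohomologySystemOfContH1 EtaleThetaDataOfSetting

variable {p : ℕ} [Fact p.Prime] {D : Literature.AnabelianGeometry.EtaleTheta.ThetaSetting p}
  {E : D.EtaleThetaData} {l : ℕ} (C : E.DoubleUnderline l) (hC : D.Compat) (hS : D.Sec2Hyps)
  (hl : l.Prime) (hp2 : p ≠ 2) (hpl : p ≠ l) (hζ : ∃ ζ : D.K, IsPrimitiveRoot ζ (4 * l))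
  (mods : ∀ M : ℕ+, D.CyclotomeMod l M)
  (f : contCocycles D.toTheta D.DeltaTheta C.GtpYdduu) (hf : f ∈ C.rootCocycles hC)
  (hmods : ∀ (M M' : ℕ+) (h : (M : ℕ) ∣ (M' : ℕ)) (x : D.lDeltaTheta l),
    MuN.red p M M' h ((mods M').red x) = (mods M).red x)
  (h15 : Literature.AnabelianGeometry.EtaleTheta.ThetaSetting.Prop15iii E hC) (L : C.CuspLabels)
  (hZ : ∀ M : ℕ+, Nonempty (ModelCyclotomes.lDeltaQuot (C.rigidData (mods M) hC hS h15 L) ≃*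
    Literature.IUT.HodgeTheaters.ZHat))
  (hcharY : EtaleThetaDataOfSetting.PiYddCharacteristic C)
  (hlim : Function.Bijective (rigidLimHom C hC hS hl hp2 hpl hζ mods f hf hmods h15 L hZ))
  [(EtaleThetaDataOfSetting.PiYdd C).Normal]

section Families

variable {M : Type} [CommMonoid M]
  (κ : M →* Multiplicative (h1Lim (phi C) (D.lDeltaTheta l) (PiYdd C) ⊥))
  (e₀ : h1Lim (phi C) (D.lDeltaTheta l) (PiYdd C) ⊥ ≃+ h1Lim (phi C) (D.lDeltaTheta l) (PiYdd C) ⊥)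

include hcharY in
/-- **J2 with EXPLICIT labels at the genuine record, inner family, `θ^ι_env`-half** ([IUTchII] Prop. 3.1 (i) p. 87):
for abc-iut-w4-d019's `thetaEnvRecord κ ι₀` (inversion actions = the inner actions of the `Π^tp_{X̲̲}`-conjugates
`g ι₀ g⁻¹`), `conj g ″ θ^i_env = θ^{g·i}_env` — the bridge's `hcompat`/`hθ` discharged by abc-iut-w4-d030
(`conj_transportLim_compat`, `image_conj_toLim_theta`) and `hι'` by `h1LimConjEquiv_conjugate`.
[claim: Mochizuki2012, status: disputed] (IUTchII §3 Prop 3.1 (i), kurims p.87) -/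
theorem image_conj_thetaEnv_thetaEnvRecord (ι₀ g i : Pi C) :
    (thetaEnvRecord C hC hS hl hp2 hpl hζ mods f hf hmods h15 L hZ hcharY hlim κ ι₀).conj g ''
        (thetaEnvRecord C hC hS hl hp2 hpl hζ mods f hf hmods h15 L hZ hcharY hlim κ ι₀).thetaEnv i =
      (thetaEnvRecord C hC hS hl hp2 hpl hζ mods f hf hmods h15 L hZ hcharY hlim κ ι₀).thetaEnv (g * i) :=
  ThetaEnvData.image_conj_toRecord_thetaEnv_eq _
    (actD := fun g => h1LimConjEquiv (phi C) (D.lDeltaTheta l) (PiYdd C) g)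
    (fun g x => conj_transportLim_compat C hC hS hl hp2 hpl hζ mods f hf hmods h15 L hZ hcharY hlim g x)
    (fun g => image_conj_toLim_theta C hC hS hl hp2 hpl hζ mods f hf hmods h15 L hZ hcharY hlim g) g
    (fun x => h1LimConjEquiv_conjugate (phi C) (D.lDeltaTheta l) (PiYdd C) ι₀ g i x)

include hcharY in
/-- **J2 with EXPLICIT labels at the genuine record, inner family, `∞θ^ι_env`-half**: `conj g ″ ∞θ^i_env = ∞θ^{g·i}_env`
for `thetaEnvRecord κ ι₀` (`hinf` by abc-iut-w4-d030's `image_conj_thetaInfty`).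
[claim: Mochizuki2012, status: disputed] (IUTchII §3 Prop 3.1 (i), kurims p.87) -/
theorem image_conj_inftyThetaEnv_thetaEnvRecord (ι₀ g i : Pi C) :
    (thetaEnvRecord C hC hS hl hp2 hpl hζ mods f hf hmods h15 L hZ hcharY hlim κ ι₀).conj g ''
        (thetaEnvRecord C hC hS hl hp2 hpl hζ mods f hf hmods h15 L hZ hcharY hlim κ ι₀).inftyThetaEnv i =
      (thetaEnvRecord C hC hS hl hp2 hpl hζ mods f hf hmods h15 L hZ hcharY hlim κ ι₀).inftyThetaEnv (g * i) :=
  ThetaEnvData.image_conj_toRecord_inftyThetaEnv_eq _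
    (actD := fun g => h1LimConjEquiv (phi C) (D.lDeltaTheta l) (PiYdd C) g)
    (fun g x => conj_transportLim_compat C hC hS hl hp2 hpl hζ mods f hf hmods h15 L hZ hcharY hlim g x)
    (fun g => image_conj_thetaInfty C hC hS hl hp2 hpl hζ mods f hf hmods h15 L hZ hcharY hlim g) g
    (fun x => h1LimConjEquiv_conjugate (phi C) (D.lDeltaTheta l) (PiYdd C) ι₀ g i x)

include hcharY in
/-- **Every label is reached from every label, inner family**: for `thetaEnvRecord κ ι₀` and labels `j`, `ι ∈ Π^tp_{X̲̲}`,
`conj (ι j⁻¹) ″ ∞θ^j_env = ∞θ^ι_env`. [claim: Mochizuki2012, status: disputed] (IUTchII §3 Prop 3.1 (i), kurims p.87) -/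
theorem exists_image_conj_inftyThetaEnv_thetaEnvRecord (ι₀ j ι : Pi C) :
    ∃ g : Pi C, (thetaEnvRecord C hC hS hl hp2 hpl hζ mods f hf hmods h15 L hZ hcharY hlim κ ι₀).conj g ''
        (thetaEnvRecord C hC hS hl hp2 hpl hζ mods f hf hmods h15 L hZ hcharY hlim κ ι₀).inftyThetaEnv j =
      (thetaEnvRecord C hC hS hl hp2 hpl hζ mods f hf hmods h15 L hZ hcharY hlim κ ι₀).inftyThetaEnv ι :=
  ⟨ι * j⁻¹, by
    rw [image_conj_inftyThetaEnv_thetaEnvRecord C hC hS hl hp2 hpl hζ mods f hf hmods h15 L hZ hcharY hlim κ ι₀,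
      inv_mul_cancel_right]⟩

include hcharY in
/-- **J2 with EXPLICIT labels at the genuine record, print-faithful OUTER family, `θ^ι_env`-half** ([IUTchII] Prop. 3.1
(i) p. 87; Rmk. 1.4.1 (ii): `ι_Ÿ` outer): for abc-iut-w4-d019's `thetaEnvRecordOuter κ e₀` (inversion actions = the
`Π^tp_{X̲̲}`-conjugates `conj_g ∘ e₀ ∘ conj_g⁻¹` of ONE action `e₀`), `conj g ″ θ^i_env = θ^{g·i}_env` — `hι'` by
`h1LimConjEquiv_conjugate_outer`, NO hypothesis on `e₀`. [claim: Mochizuki2012, status: disputed] (IUTchII §3 Prop 3.1 (i), kurims p.87) -/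
theorem image_conj_thetaEnv_thetaEnvRecordOuter (g i : Pi C) :
    (thetaEnvRecordOuter C hC hS hl hp2 hpl hζ mods f hf hmods h15 L hZ hcharY hlim κ e₀).conj g ''
        (thetaEnvRecordOuter C hC hS hl hp2 hpl hζ mods f hf hmods h15 L hZ hcharY hlim κ e₀).thetaEnv i =
      (thetaEnvRecordOuter C hC hS hl hp2 hpl hζ mods f hf hmods h15 L hZ hcharY hlim κ e₀).thetaEnv (g * i) :=
  ThetaEnvData.image_conj_toRecord_thetaEnv_eq _
    (actD := fun g => h1LimConjEquiv (phi C) (D.lDeltaTheta l) (PiYdd C) g)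
    (fun g x => conj_transportLim_compat C hC hS hl hp2 hpl hζ mods f hf hmods h15 L hZ hcharY hlim g x)
    (fun g => image_conj_toLim_theta C hC hS hl hp2 hpl hζ mods f hf hmods h15 L hZ hcharY hlim g) g
    (fun x => h1LimConjEquiv_conjugate_outer (phi C) (D.lDeltaTheta l) (PiYdd C) e₀ g i x)

include hcharY in
/-- **J2 with EXPLICIT labels at the genuine record, OUTER family, `∞θ^ι_env`-half**: `conj g ″ ∞θ^i_env = ∞θ^{g·i}_env`
for `thetaEnvRecordOuter κ e₀`. [claim: Mochizuki2012, status: disputed] (IUTchII §3 Prop 3.1 (i), kurims p.87) -/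
theorem image_conj_inftyThetaEnv_thetaEnvRecordOuter (g i : Pi C) :
    (thetaEnvRecordOuter C hC hS hl hp2 hpl hζ mods f hf hmods h15 L hZ hcharY hlim κ e₀).conj g ''
        (thetaEnvRecordOuter C hC hS hl hp2 hpl hζ mods f hf hmods h15 L hZ hcharY hlim κ e₀).inftyThetaEnv i =
      (thetaEnvRecordOuter C hC hS hl hp2 hpl hζ mods f hf hmods h15 L hZ hcharY hlim κ e₀).inftyThetaEnv (g * i) :=
  ThetaEnvData.image_conj_toRecord_inftyThetaEnv_eq _
    (actD := fun g => h1LimConjEquiv (phi C) (D.lDeltaTheta l) (PiYdd C) g)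
    (fun g x => conj_transportLim_compat C hC hS hl hp2 hpl hζ mods f hf hmods h15 L hZ hcharY hlim g x)
    (fun g => image_conj_thetaInfty C hC hS hl hp2 hpl hζ mods f hf hmods h15 L hZ hcharY hlim g) g
    (fun x => h1LimConjEquiv_conjugate_outer (phi C) (D.lDeltaTheta l) (PiYdd C) e₀ g i x)

include hcharY in
/-- **Every label is reached from every label, OUTER family**: `conj (ι j⁻¹) ″ ∞θ^j_env = ∞θ^ι_env` for
`thetaEnvRecordOuter κ e₀`. [claim: Mochizuki2012, status: disputed] (IUTchII §3 Prop 3.1 (i), kurims p.87) -/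
theorem exists_image_conj_inftyThetaEnv_thetaEnvRecordOuter (j ι : Pi C) :
    ∃ g : Pi C, (thetaEnvRecordOuter C hC hS hl hp2 hpl hζ mods f hf hmods h15 L hZ hcharY hlim κ e₀).conj g ''
        (thetaEnvRecordOuter C hC hS hl hp2 hpl hζ mods f hf hmods h15 L hZ hcharY hlim κ e₀).inftyThetaEnv j =
      (thetaEnvRecordOuter C hC hS hl hp2 hpl hζ mods f hf hmods h15 L hZ hcharY hlim κ e₀).inftyThetaEnv ι :=
  ⟨ι * j⁻¹, by
    rw [image_conj_inftyThetaEnv_thetaEnvRecordOuter C hC hS hl hp2 hpl hζ mods f hf hmods h15 L hZ hcharY hlim κ e₀,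
      inv_mul_cancel_right]⟩

/-! #### With abc-iut-w4-d007's Kummer map of a `Π`-stable constant monoid `O` (`Ψ_cns := M_TM`) -/

variable {A : Type} [CommGroup A] [MulDistribMulAction (Pi C) A] [TopologicalSpace A] [RootableBy A ℕ]
  (c : CyclotomeCoefficients (phi C) (D.lDeltaTheta l) A)
  (hA : ∀ b : A, IsOpen (MulAction.stabilizer (Pi C) b : Set (Pi C)))
  (hfi : ∀ b : A, (MulAction.stabilizer (Pi C) b).FiniteIndex)
  (O : Submonoid A) (hO : ∀ (σ : Pi C) (b : A), b ∈ O → σ • b ∈ O)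

include hcharY hO in
/-- **The PACKAGED [IUTchII] Prop. 3.1 (i)(ii) structure AT THE GENUINE RECORD, inner family** (p. 87 l. 47–53, p. 88):
for abc-iut-w4-d019's `thetaEnvRecordKummer … c hA hfi O ι₀` (genuine `θ_env` data of the natural system of `X̲̲_K`,
conjugation action `h1LimConjMulAut` of `Π^tp_{X̲̲}`, `Ψ_cns := κ(O)` for abc-iut-w4-d007's Kummer map of a
`Π^tp_{X̲̲}`-stable constant monoid `O`, inversion actions the inner conjugates of `ι₀`), the WHOLE of abc-iut-L6-t2's
`Prop31Statements` holds as soon as `(M^×_TM, ⟨∞θ^j_env⟩)` is a splitting up to torsion at ONE label `j` —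
`conj_permutes`/`constants_stable` from `ThetaEnvDataRecordModel.lean`, `splitting` at every label by transport
along J2 (this file). The one-label input `hsplit` is supplied BY NAME by any landed J3 closer (abc-iut-w4-d004
`splitting_toRecord_padic_of_eval` p433555; abc-iut-w4-d035 `…_inversion_of_thetaKummerOrbit` p488082 for its
family). Remaining hypotheses: `hO` and `hsplit`; the record inputs (incl. (H1) `hcharY` = F-2633 at the instance)
are the parameters of the record. [claim: Mochizuki2012, status: disputed] (IUTchII §3 Prop 3.1 (i), kurims p.87) -/
theorem prop31Statements_thetaEnvRecordKummer_of_splitting_at (ι₀ j : Pi C)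
    (hsplit : TemperedThetaMonoids.IsSplittingUpToTorsion
      (thetaEnvRecordKummer C hC hS hl hp2 hpl hζ mods f hf hmods h15 L hZ hcharY hlim c hA hfi O ι₀).units
      (Submonoid.closure
        ((thetaEnvRecordKummer C hC hS hl hp2 hpl hζ mods f hf hmods h15 L hZ hcharY hlim c hA hfi O ι₀).inftyThetaEnv
          j))) :
    TemperedThetaMonoids.Prop31Statements
      (thetaEnvRecordKummer C hC hS hl hp2 hpl hζ mods f hf hmods h15 L hZ hcharY hlim c hA hfi O ι₀) := by
  refine TemperedThetaMonoids.ThetaEnvData.prop31Statements_of_splitting_at _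
    (thetaEnvPermuted_thetaEnvRecord C hC hS hl hp2 hpl hζ mods f hf hmods h15 L hZ hcharY hlim _ ι₀)
    (constantMonoid_stable_thetaEnvRecord C hC hS hl hp2 hpl hζ mods f hf hmods h15 L hZ hcharY hlim c hA hfi O hO ι₀)
    j ?_ hsplit
  intro ι
  exact exists_image_conj_inftyThetaEnv_thetaEnvRecord C hC hS hl hp2 hpl hζ mods f hf hmods h15 L hZ hcharY hlim _
    ι₀ j ι

include hcharY hO in
/-- **The PACKAGED [IUTchII] Prop. 3.1 (i)(ii) structure AT THE GENUINE RECORD, print-faithful OUTER family** (p. 87;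
Rmk. 1.4.1 (ii) p. 28): for abc-iut-w4-d019's `thetaEnvRecordOuterKummer … e₀ c hA hfi O` (inversion actions the
`Π^tp_{X̲̲}`-conjugates of ONE action `e₀` — e.g. the transport of the pointed inversion pair `(ι_Ÿ, ι^Θ)` of record),
the WHOLE `Prop31Statements` holds as soon as `(M^×_TM, ⟨∞θ^j_env⟩)` is a splitting up to torsion at ONE label `j`
(`conj_permutes`/`constants_stable` from `ThetaEnvDataRecordModelOuter.lean`; `splitting` everywhere by transport).
Remaining hypotheses: `hO`, `hsplit`. [claim: Mochizuki2012, status: disputed] (IUTchII §3 Prop 3.1 (i), kurims p.87) -/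
theorem prop31Statements_thetaEnvRecordOuterKummer_of_splitting_at (j : Pi C)
    (hsplit : TemperedThetaMonoids.IsSplittingUpToTorsion
      (thetaEnvRecordOuterKummer C hC hS hl hp2 hpl hζ mods f hf hmods h15 L hZ hcharY hlim e₀ c hA hfi O).units
      (Submonoid.closure
        ((thetaEnvRecordOuterKummer C hC hS hl hp2 hpl hζ mods f hf hmods h15 L hZ hcharY hlim e₀ c hA hfi O).inftyThetaEnv
          j))) :
    TemperedThetaMonoids.Prop31Statements
      (thetaEnvRecordOuterKummer C hC hS hl hp2 hpl hζ mods f hf hmods h15 L hZ hcharY hlim e₀ c hA hfi O) := by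
  refine TemperedThetaMonoids.ThetaEnvData.prop31Statements_of_splitting_at _
    (thetaEnvPermuted_thetaEnvRecordOuter C hC hS hl hp2 hpl hζ mods f hf hmods h15 L hZ hcharY hlim _ e₀)
    (constantMonoid_stable_thetaEnvRecordOuter C hC hS hl hp2 hpl hζ mods f hf hmods h15 L hZ hcharY hlim
      e₀ c hA hfi O hO)
    j ?_ hsplit
  intro ι
  exact exists_image_conj_inftyThetaEnv_thetaEnvRecordOuter C hC hS hl hp2 hpl hζ mods f hf hmods h15 L hZ hcharY hlim
    _ e₀ j ι

end Families

/-! ### §4. Over `ℚ̄_pˣ`: the packaged structure from the Cor. 3.5 (K)/(E) DATA at one label (∘ p433555) -/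

section Padic

open TemperedThetaMonoids BadPrimeGaussianMonoids

variable {P₀ : TopGroup.{0}} (φ₀ : P₀ →* D.GtpTheta) (s₀ : P₀ →* Pi C)
  (hι : Continuous ((MonoidHom.id (Pi C)).comp s₀))
  (hN : (⊤ : Subgroup P₀).map ((MonoidHom.id (Pi C)).comp s₀) ≤ PiYdd C)
  (hφ : (phi C).comp ((MonoidHom.id (Pi C)).comp s₀) = φ₀)
  [TopologicalSpace (PadicAlgCl p)ˣ]
  (c : CyclotomeCoefficients (phi C) (D.lDeltaTheta l) (PadicAlgCl p)ˣ)
  (hA : ∀ b : (PadicAlgCl p)ˣ, IsOpen (MulAction.stabilizer (Pi C) b : Set (Pi C)))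
  (hfi : ∀ b : (PadicAlgCl p)ˣ, (MulAction.stabilizer (Pi C) b).FiniteIndex)
  (O : Submonoid (PadicAlgCl p)ˣ) (hO : ∀ (σ : Pi C) (b : (PadicAlgCl p)ˣ), b ∈ O → σ • b ∈ O)
  [MulDistribMulAction P₀ (PadicAlgCl p)ˣ]
  (c₀ : CyclotomeCoefficients φ₀ (D.lDeltaTheta l) (PadicAlgCl p)ˣ)
  (hA₀ : ∀ b : (PadicAlgCl p)ˣ, IsOpen (MulAction.stabilizer P₀ b : Set P₀))
  (hfi₀ : ∀ b : (PadicAlgCl p)ˣ, (MulAction.stabilizer P₀ b).FiniteIndex)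

include hcharY hO in
/-- **[IUTchII] Prop. 3.1 (i)(ii) — the PACKAGED `Prop31Statements` AT THE GENUINE `θ_env` RECORD over `ℚ̄_pˣ`**
(inner inversion family `thetaEnvRecordKummer … c hA hfi O ι₀`; p. 87 l. 47–53 «conjugation action … splittings up to
torsion», p. 88 «`Ψ_cns` … conjugation action»): §3's `prop31Statements_thetaEnvRecordKummer_of_splitting_at` with the
one-label splitting SUPPLIED by abc-iut-w4-d004's `splitting_toRecord_padic_of_eval` (p433555) at the label `j`
carrying the Cor. 3.5 data. Residual hypotheses BY NAME (exactly p433555's plus `hO`): ONE continuous evaluation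
section `s₀ : G_v → Π^tp_{X̲̲}` into `Π^tp_{Ÿ̲̲}` with coefficient action `φ₀` and finite-index `ε`-image, `G_v` acting on
`ℚ̄_pˣ` as through it (`hact`); `c`, `c₀` bijective with the same underlying homomorphism; a `Π^tp_{X̲̲}`-stable constant
monoid `O` (`hO`); `horb` (`θ^j_env` is one `M^×_TM`-orbit) and `htors` (`M^μ_TM ⊆ M^×_TM`) at the record; and (E):
`R₀ θ = κ₀ q` for the restriction `R₀ = h1LimCongr ∘ s₀^*`, some `θ ∈ θ^j_env` and some NON-UNIT `q ∈ O`. The record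
inputs (incl. (H1) `hcharY` = F-2633 at the instance, `h15`, `hZ`, `hlim`) are parameters of the record. No FACT-LIST
row is consumed. [claim: Mochizuki2012, status: disputed] (IUTchII §3 Prop 3.1 (i), kurims p.87) -/
theorem prop31Statements_thetaEnvRecordKummer_padic_of_eval (ι₀ : Pi C) (hc : Function.Bijective c.hom)
    (hc₀ : Function.Bijective c₀.hom) (hc₀c : ∀ ζ, c₀.hom ζ = c.hom ζ)
    (hact : ∀ (g : P₀) (a : (PadicAlgCl p)ˣ), g • a = s₀ g • a)
    [((EtaleThetaDataOfSetting.aug C).comp s₀).range.FiniteIndex]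
    {j : Pi C}
    {θ : (thetaEnvRecordKummer C hC hS hl hp2 hpl hζ mods f hf hmods h15 L hZ hcharY hlim c hA hfi O ι₀).H}
    (hθ : θ ∈ (thetaEnvRecordKummer C hC hS hl hp2 hpl hζ mods f hf hmods h15 L hZ hcharY hlim c hA hfi O ι₀).thetaEnv j)
    (horb : ∀ θ' ∈ (thetaEnvRecordKummer C hC hS hl hp2 hpl hζ mods f hf hmods h15 L hZ hcharY hlim
        c hA hfi O ι₀).thetaEnv j,
      ∃ u ∈ (thetaEnvRecordKummer C hC hS hl hp2 hpl hζ mods f hf hmods h15 L hZ hcharY hlim c hA hfi O ι₀).units,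
        θ' = u * θ)
    (htors : ∀ u : (thetaEnvRecordKummer C hC hS hl hp2 hpl hζ mods f hf hmods h15 L hZ hcharY hlim c hA hfi O ι₀).H,
      IsOfFinOrder u →
        u ∈ (thetaEnvRecordKummer C hC hS hl hp2 hpl hζ mods f hf hmods h15 L hZ hcharY hlim c hA hfi O ι₀).units)
    (R₀ : (thetaEnvRecordKummer C hC hS hl hp2 hpl hζ mods f hf hmods h15 L hZ hcharY hlim c hA hfi O ι₀).H →*
      Multiplicative (h1Lim φ₀ (D.lDeltaTheta l) (⊤ : Subgroup P₀) ⊥))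
    (hR₀ : ∀ y, Multiplicative.toAdd (R₀ y) =
      h1LimCongr (D.lDeltaTheta l) ⊤ hφ ⊥
        (h1LimComap (phi C) (D.lDeltaTheta l) ((MonoidHom.id (Pi C)).comp s₀) hι hN
          (AddEquiv.additiveMultiplicative (h1Lim (phi C) (D.lDeltaTheta l) (PiYdd C) ⊥) (Additive.ofMul y))))
    (q : O) (hRθ : R₀ θ = h1LimKummerOn φ₀ (D.lDeltaTheta l) ⊤ c₀ hA₀ hfi₀ O q) (hq : ¬ IsUnit q) :
    TemperedThetaMonoids.Prop31Statements
      (thetaEnvRecordKummer C hC hS hl hp2 hpl hζ mods f hf hmods h15 L hZ hcharY hlim c hA hfi O ι₀) := by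
  refine prop31Statements_thetaEnvRecordKummer_of_splitting_at C hC hS hl hp2 hpl hζ mods f hf hmods h15 L hZ hcharY
    hlim c hA hfi O hO ι₀ j ?_
  exact (splitting_toRecord_padic_of_eval C hC hS hl hp2 hpl hζ mods f hf hmods h15 L hZ hcharY hlim
    (fun g : Pi C => h1LimConjEquiv (phi C) (D.lDeltaTheta l) (PiYdd C) (g * ι₀ * g⁻¹)) φ₀ s₀ hι hN hφ c hA hfi O c₀
    hA₀ hfi₀ hc hc₀ hc₀c hact hθ horb htors R₀ hR₀ q hRθ hq).1

end Padic

end EtaleLevels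

end Literature.IUT.HodgeArakelov

end
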